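import Summits.PneNP.PneNP.Theorems.OneSliceSliceTargetFibreCliqueUpper

/-!
# Line `Sketch-ideator3-r1` for crux `SliceTarget` (stmt-PneNP-2832) — stub T4θ `FibreCliqueUpperSub`

Stub `stub_fibreCliqueUpperSub` of the line skeleton `Cruxes/SliceTarget/Lines/Sketch_ideator3_r1.lean` (namespace
`Summit.PneNP.PneNP.Cruxes.SliceTarget.Ideator3Line`): the upper fibre clique bound of T4 (`stub_fibreCliqueUpper`,
Theorems/OneSliceSliceTargetFibreCliqueUpper.lean, p87716) under the sub-threshold read-set cap `8·#F ≤ m_k(n)` instead of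
`#F ≤ 3n`, every `k ≥ 3`: on each fibre of a central slice at least half of the graphs have no `k`-clique avoiding `F` (first
moment on the sub-box). It is the hypothesis `FibreCliqueUpperSub` of the landed window transfer `stub_transferWindow`
(Theorems/OneSliceSliceTargetSubthreshold.lean, p90126).

Proof by lead prover-line-stmt-PneNP-2832-0 (2026-08-16, rc 0 inside skeleton v5–v8); landed by the continuation lead
prover-line-stmt-PneNP-2832-c1-0.
-/

set_option linter.dupNamespace false

namespace Summit.PneNP.PneNP.Cruxes.SliceTarget.Ideator3Line

open Literature.Computability.Complexity Finset Filter Classical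
open scoped Topology
open Summit.PneNP.PneNP.Theorems.ConstantBand.Negative (Edge thr Central slice)
open Summit.PneNP.PneNP.Theorems.SingleThreshold.Negative (Edges zeroOn pc pc_nonneg pc_le_one tendsto_pc
  firstMoment_pc_le)

noncomputable section

/-- **stub T4θ `stub_fibreCliqueUpperSub`** of line `Sketch-ideator3-r1` (crux stmt-PneNP-2832): T4 with the read-set cap
`#F ≤ 3n` replaced by `8·#F ≤ m_k(n)` (`k ≥ 3`): on every fibre `{x ∈ slice_j : x|_F = ρ|_F}` of a central slice at least HALF
of the graphs have NO `k`-clique avoiding `F` — first moment on the sub-box (`card_fibre_clique_le`, `card_fibre_split` from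
Theorems/OneSliceSliceTargetFibreCliqueUpper.lean): `P[ω' ≥ 1] ≤ E ω' ≤ C(n,k)·((j − r)/(N − #F))^K ≤ (1/k!)(1 + o(1)) ≤ 1/2`
since `N/(N − m_k(n)/8) → 1`. Feeds the sub-threshold floor `sliceLB_subthreshold_of`. [folklore] -/
theorem stub_fibreCliqueUpperSub :
    ∀ k : ℕ, 3 ≤ k → ∀ᶠ n : ℕ in atTop, ∀ j : ℕ, Central k n j →
      ∀ F : Finset (Edge n), 8 * #F ≤ thr k n → ∀ ρ : Edge n → Bool,
        (1 / 2 : ℝ) * #((slice n j).filter fun x => ∀ e ∈ F, x e = ρ e) ≤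
          #((slice n j).filter fun x => (∀ e ∈ F, x e = ρ e) ∧ cliqueFn n k (zeroOn F x) = false) := by
  intro k hk
  have hk2 : 2 ≤ k := by omega
  -- the correction factor `u_n = (1 + m^{-1/4}) (1 + p/4)` tends to `1`, so `u_n ^ K < 3` eventually
  have h0 : Tendsto (fun n : ℕ => (thr k n : ℝ) ^ (-(1 / 4 : ℝ))) atTop (𝓝 0) :=
    (tendsto_rpow_neg_atTop (by norm_num)).comp (tendsto_thr_atTop hk)
  have hp4 : Tendsto (fun n : ℕ => pc n k / 4) atTop (𝓝 0) := by
    have h := (tendsto_pc hk2).div_const 4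
    rwa [zero_div] at h
  have hu : Tendsto (fun n : ℕ =>
      ((1 + (thr k n : ℝ) ^ (-(1 / 4 : ℝ))) * (1 + pc n k / 4)) ^ k.choose 2) atTop (𝓝 1) := by
    have h := (((tendsto_const_nhds (x := (1 : ℝ))).add h0).mul
      ((tendsto_const_nhds (x := (1 : ℝ))).add hp4)).pow (k.choose 2)
    simpa using h
  have hu3 : ∀ᶠ n : ℕ in atTop,
      ((1 + (thr k n : ℝ) ^ (-(1 / 4 : ℝ))) * (1 + pc n k / 4)) ^ k.choose 2 < 3 :=
    hu.eventually (gt_mem_nhds (by norm_num))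
  filter_upwards [hu3, eventually_ge_atTop 2, (tendsto_thr_atTop hk).eventually_gt_atTop 0] with n hun hn
    hm0 j hj F hF ρ
  have hn1 : 1 ≤ n := by omega
  have hn0 : (0 : ℝ) < n := by exact_mod_cast (show 0 < n by omega)
  -- Step 1: counting on the fibre
  have hmom := card_fibre_clique_le j F ρ hk2
  have hsplit := card_fibre_split j k F ρ
  set r : ℕ := #(F.filter fun e => ρ e = true) with hr_def
  set N : ℕ := n.choose 2 with hN_def
  set q : ℝ := ((j - r : ℕ) : ℝ) / ((N - #F : ℕ) : ℝ) with hq_def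
  set u : ℝ := (1 + (thr k n : ℝ) ^ (-(1 / 4 : ℝ))) * (1 + pc n k / 4) with hu_def
  -- Step 2: `q ≤ p_c · u`
  have hNpos : 0 < N := by rw [hN_def]; exact Nat.choose_pos (by omega)
  have hNr : (0 : ℝ) < N := by exact_mod_cast hNpos
  have hp0 : 0 ≤ pc n k := pc_nonneg n k
  have hp1 : pc n k ≤ 1 := pc_le_one hn1 hk2
  have hmN : (thr k n : ℝ) ≤ (N : ℝ) * pc n k := by
    rw [hN_def, thr, pc]
    exact Nat.floor_le (by positivity)
  -- `#F ≤ thr/8 ≤ N p / 8 ≤ N / 8`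
  have hF8 : 8 * (#F : ℝ) ≤ (N : ℝ) * pc n k := le_trans (by exact_mod_cast hF) hmN
  have hFN8 : 8 * (#F : ℝ) ≤ N := hF8.trans (mul_le_of_le_one_right hNr.le hp1)
  have hFN : #F < N := by
    have h : ((#F : ℕ) : ℝ) < N := by linarith
    exact_mod_cast h
  have hden : (0 : ℝ) < (N : ℝ) - #F := by
    have : ((#F : ℕ) : ℝ) < N := by exact_mod_cast hFN
    linarith
  have hq0 : 0 ≤ q := div_nonneg (Nat.cast_nonneg _) (Nat.cast_nonneg _)
  have hq1 : q ≤ (j : ℝ) / ((N : ℝ) - #F) := by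
    rw [hq_def, Nat.cast_sub hFN.le]
    exact div_le_div₀ (Nat.cast_nonneg _) (by exact_mod_cast Nat.sub_le j r) hden le_rfl
  have hs0 : (0 : ℝ) ≤ (thr k n : ℝ) ^ (-(1 / 4 : ℝ)) := Real.rpow_nonneg hm0.le _
  have hjm : (j : ℝ) ≤ (thr k n : ℝ) * (1 + (thr k n : ℝ) ^ (-(1 / 4 : ℝ))) := by
    have h1 : (j : ℝ) - thr k n ≤ (thr k n : ℝ) ^ ((3 : ℝ) / 4) := (abs_sub_le_iff.1 hj).1
    have h34 : (thr k n : ℝ) ^ ((3 : ℝ) / 4) = (thr k n : ℝ) * (thr k n : ℝ) ^ (-(1 / 4 : ℝ)) := by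
      rw [show ((3 : ℝ) / 4) = 1 + -(1 / 4 : ℝ) by norm_num, Real.rpow_add hm0, Real.rpow_one]
    rw [mul_add, mul_one, ← h34]
    linarith
  -- `N / (N - #F) ≤ 1 + p/4` since `#F/N ≤ p/8 ≤ 1/8`
  have hratio : (N : ℝ) / ((N : ℝ) - #F) ≤ 1 + pc n k / 4 := by
    rw [div_le_iff₀ hden]
    -- `N ≤ (1 + p/4)(N - #F) ⟸ #F (1 + p/4) ≤ N p/4 ⟸ 8 #F ≤ N p` and `p ≤ 1`
    have hF0 : (0 : ℝ) ≤ #F := Nat.cast_nonneg _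
    nlinarith
  have hqu : q ≤ pc n k * u := by
    calc q ≤ (j : ℝ) / ((N : ℝ) - #F) := hq1
      _ ≤ (N : ℝ) * pc n k * (1 + (thr k n : ℝ) ^ (-(1 / 4 : ℝ))) / ((N : ℝ) - #F) := by
          apply div_le_div_of_nonneg_right _ hden.le
          exact hjm.trans (mul_le_mul_of_nonneg_right hmN (by linarith))
      _ = pc n k * (1 + (thr k n : ℝ) ^ (-(1 / 4 : ℝ))) * ((N : ℝ) / ((N : ℝ) - #F)) := by ring
      _ ≤ pc n k * (1 + (thr k n : ℝ) ^ (-(1 / 4 : ℝ))) * (1 + pc n k / 4) :=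
          mul_le_mul_of_nonneg_left hratio (mul_nonneg (pc_nonneg n k) (by linarith))
      _ = pc n k * u := by rw [hu_def]; ring
  -- Step 3: the coefficient is at most `1/2`
  have hu0 : 0 ≤ u := by rw [hu_def]; exact mul_nonneg (by linarith) (by positivity)
  have hcoef : (n.choose k : ℝ) * q ^ k.choose 2 ≤ 1 / 2 := by
    have hfac : (6 : ℝ) ≤ k.factorial := by
      have h : (3 : ℕ).factorial ≤ k.factorial := Nat.factorial_le hk
      exact_mod_cast h
    calc (n.choose k : ℝ) * q ^ k.choose 2 ≤ (n.choose k : ℝ) * (pc n k * u) ^ k.choose 2 :=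
          mul_le_mul_of_nonneg_left (pow_le_pow_left₀ hq0 hqu _) (Nat.cast_nonneg _)
      _ = (n.choose k : ℝ) * pc n k ^ k.choose 2 * u ^ k.choose 2 := by rw [mul_pow, mul_assoc]
      _ ≤ 1 / (k.factorial : ℝ) * u ^ k.choose 2 :=
          mul_le_mul_of_nonneg_right (firstMoment_pc_le hn1 hk2) (pow_nonneg hu0 _)
      _ ≤ 1 / 6 * 3 :=
          mul_le_mul (one_div_le_one_div_of_le (by norm_num) hfac) hun.le (pow_nonneg hu0 _)
            (by norm_num)
      _ = 1 / 2 := by norm_num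
  -- Step 4: assemble
  linarith [hmom.trans (mul_le_mul_of_nonneg_right hcoef (Nat.cast_nonneg _))]

end

end Summit.PneNP.PneNP.Cruxes.SliceTarget.Ideator3Line
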